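import Literature.Computability.Cryptography.PRPSwitchingLemma
import HarnessLib

/-!
# Zhandry's `PRF^mod`, II: the reduced oracle and the mod-`a` collision lemma

Topic `Literature/Computability/Cryptography`. Second layer (after `ZhandryPRFMod.lean` and the
switching lemma `PRPSwitchingLemma.lean`) below the named fact
`aaronsonChen2017_lem75_prfMod_isPRF` (S. Aaronson, L. Chen, *Complexity-theoretic foundations of
quantum supremacy experiments*, CCC 2017, arXiv:1612.05903, Lemma 7.5 (1), second half: Zhandry's
`PRF^mod` is a classically secure PRF). This file proves the INFORMATION-THEORETIC step of the
printed proof (App. 13, p. 42, eq. (neg-lig)):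

> "We first show that if the `PRP^raw` in the definition of `PRF^mod` were replaced by a truly
> random function, then no classical polynomial-time algorithm `A` could distinguish it from a
> truly random function … Clearly, as long as `A` never queries its oracle on two points `x` and
> `x'` such that `x ≡ x' (mod a)`, the oracle will look random. Suppose `A` makes `q` queries in
> total. There are `q choose 2` possible differences between query points … each difference can be
> divisible by at most two different moduli … the total probability of querying two `x` and `x'`
> such that `x ≡ x' (mod a)` is at most `O(q² log N / √N)`."

in the tree's transcript model, for an ARBITRARY finite set `A` of moduli and a bound `D` on the
number of moduli of `A` dividing one nonzero difference (for Zhandry's moduli — the primes in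
`[√N/4, √N/2]` — `D = 2`, proved with the size of `A` in `ZhandryModuliCount.lean`):

* `reduceOracle a O : q ↦ O (q mod a)` (reduction of the query, read as a little-endian number of
  its own length; `oracleOfFnAt_prfMod`: the oracle of `PRF^mod_{(k,a)}` IS the reduced oracle of
  `PRP^raw_k`, and ill-formed queries stay ill-formed);
* `abs_prF_reduce_sub_prF_le` — **identical until a collision**, conditioned on partial tables
  (the lazy-sampling states `PTable` of `PRPSwitchingLemma.lean`): for a deterministic transcript
  algorithm `M`, a FIXED modulus `a`, and a uniformly random function table `h` on `{0,1}^m`, the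
  probabilities of any output event for `M` run against `h ∘ (mod a)` and against `h` differ by at
  most the probability that the run against `h` asks two distinct well-formed queries congruent
  modulo `a` (induction on the fuel: a repeated query and an ill-formed query are answered alike in
  both games; a fresh query not congruent to an earlier one is a fresh point of BOTH tables and is
  lazily sampled alike, `prF_fresh`; a fresh query congruent to an earlier one is the collision);
* `card_filter_coll_le`, `sum_prF_coll_le` — the union bound: summed over `a ∈ A`, the collision
  probabilities are at most `k² · D` (`k` = fuel ≥ number of queries);
* `prfIdealModProb ℓ a 𝒜 n = Pr_H[𝒜^{H ∘ (mod a)}(1ⁿ) = 1]` (the ideal game of the reduced oracle)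
  and the adversary form `abs_avg_prfIdealModProb_sub_prfIdealProb_le`:
  `|(1/|A|) ∑_{a ∈ A} Pr_H[𝒜^{H∘(mod a)} = 1] − Pr_H[𝒜^H = 1]| ≤ fuel(n)² · D / |A|`.

The computational step (replacing `PRP^raw_k` by the random `h`, which needs a probabilistic
polynomial-time sampler of the moduli) and the assembly are in the sequel files.

## References

* [AaronsonChen2017] S. Aaronson, L. Chen, CCC 2017 (arXiv:1612.05903), §7.2 (p. 29), Lemma 7.5
  and App. 13 (pp. 30, 42).
* [Zhandry2012] M. Zhandry, *How to construct quantum random functions*, FOCS 2012, Claim 1 (the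
  original statement; cited through [AaronsonChen2017]).
* M. Bellare, P. Rogaway, EUROCRYPT 2006 (the "identical-until-bad" game-playing technique;
  background only).
-/

namespace Literature.Computability.Cryptography

open Filter Asymptotics _root_.Computability Complexity Finset

/-! ### The reduced oracle `q ↦ O (q mod a)` -/

/-- **The reduced oracle**: `reduceOracle a O` answers the query `q` by `O (q mod a)`, the query
being read as a little-endian number of its own length `|q|` and reduced modulo `a`
(`modReduce |q| a q`, of the same length). For `O = PRP^raw_k` on `{0,1}^{ℓ n}` this is the oracle
of `PRF^mod_{(k,a)}` (`oracleOfFnAt_prfMod`). [cite: AaronsonChen2017, §7.2 (p. 29)] -/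
def reduceOracle (a : ℕ) (O : Oracle) : Oracle :=
  fun q => O (modReduce q.length a q)

/-- Unfolding `reduceOracle`. [cite: AaronsonChen2017, §7.2 (p. 29)] -/
theorem reduceOracle_apply (a : ℕ) (O : Oracle) (q : List Bool) :
    reduceOracle a O q = O (modReduce q.length a q) :=
  rfl

/-- Reducing the queries of a length-`m` function oracle gives the length-`m` oracle of the
reduced function (ill-formed queries stay ill-formed, since `modReduce` preserves the length).
[cite: AaronsonChen2017, §7.2 (p. 29)] -/
theorem reduceOracle_oracleOfFnAt (m a : ℕ) (h : List Bool → List Bool) :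
    reduceOracle a (oracleOfFnAt m h) = oracleOfFnAt m fun q => h (modReduce m a q) := by
  funext q
  by_cases hq : q.length = m
  · rw [reduceOracle_apply, oracleOfFnAt_apply_of_length_eq _ hq,
      oracleOfFnAt_apply_of_length_eq _ (by rw [length_modReduce]; exact hq), hq]
  · rw [reduceOracle_apply, oracleOfFnAt_apply_of_length_ne _ hq,
      oracleOfFnAt_apply_of_length_ne _ (by rw [length_modReduce]; exact hq)]

/-- **The oracle of `PRF^mod_{(k,a)}` is the reduced oracle of `PRP^raw_k`** (both on queries of
length `ℓ n`): "`PRF^mod_{(k,a)}(x) = PRP^raw_k((x − 1) mod a + 1)`". [cite: AaronsonChen2017, §7.2 (p. 29)] -/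
theorem oracleOfFnAt_prfMod (F : FunctionEnsemble) (ℓ : ℕ → ℕ) (n : ℕ) (k : List Bool) (a : ℕ) :
    oracleOfFnAt (ℓ n) (prfMod F ℓ n k a) = reduceOracle a (oracleOfFnAt (ℓ n) (F n k)) := by
  rw [reduceOracle_oracleOfFnAt]
  rfl

/-! ### Reduced points of `{0,1}^m` and congruence of queries -/

section Collision

variable {β : Type} {m : ℕ}

/-- Reading back fixed-width digits (a local copy of the tree lemma
`Literature.Computability.Complexity.natBits_bitsToNat` of `MajorityEnumeration.lean`, not imported
here). [folklore] -/
private theorem natBits_bitsToNat_aux : ∀ l : List Bool, Complexity.natBits l.length (bitsToNat l) = l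
  | [] => rfl
  | b :: l => by
    rw [List.length_cons, Complexity.natBits, bitsToNat_cons]
    have h2 : (b.toNat + 2 * bitsToNat l) / 2 = bitsToNat l := by
      cases b <;> simp only [Bool.toNat_false, Bool.toNat_true] <;> omega
    have h1 : decide ((b.toNat + 2 * bitsToNat l) % 2 = 1) = b := by
      cases b <;>
        simp only [Bool.toNat_false, Bool.toNat_true, decide_eq_true_eq, decide_eq_false_iff_not] <;> omega
    rw [h1, h2, natBits_bitsToNat_aux l]

/-- The reduced point `v mod a` of `{0,1}^m` (`modReduce` on vectors). [cite: AaronsonChen2017, §7.2 (p. 29)] -/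
def redV (a : ℕ) (v : List.Vector Bool m) : List.Vector Bool m :=
  ⟨modReduce m a v.toList, length_modReduce _ _ _⟩

/-- The underlying string of the reduced point. [cite: AaronsonChen2017, §7.2 (p. 29)] -/
@[simp] theorem toList_redV (a : ℕ) (v : List.Vector Bool m) : (redV a v).toList = modReduce m a v.toList :=
  rfl

/-- **Two points have the same reduction iff they are congruent modulo `a`** (as little-endian
numbers; no hypothesis on `a`: for `a = 0` both sides say `v = w`). [cite: AaronsonChen2017, App. 13 (p. 42)] -/
theorem redV_eq_redV_iff (a : ℕ) (v w : List.Vector Bool m) :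
    redV a v = redV a w ↔ bitsToNat v.toList % a = bitsToNat w.toList % a := by
  constructor
  · intro h
    have h' := congrArg (fun u : List.Vector Bool m => bitsToNat u.toList) h
    simp only [toList_redV, modReduce] at h'
    have hv : bitsToNat v.toList % a < 2 ^ m :=
      lt_of_le_of_lt (Nat.mod_le _ _) (by simpa using bitsToNat_lt v.toList)
    have hw : bitsToNat w.toList % a < 2 ^ m :=
      lt_of_le_of_lt (Nat.mod_le _ _) (by simpa using bitsToNat_lt w.toList)
    rwa [Complexity.bitsToNat_natBits hv, Complexity.bitsToNat_natBits hw] at h'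
  · intro h
    apply List.Vector.toList_injective
    simp only [toList_redV]
    exact modReduce_eq_of_mod_eq h

/-- Distinct points of `{0,1}^m` are distinct as numbers. [folklore] -/
theorem bitsToNat_toList_injective : Function.Injective fun v : List.Vector Bool m => bitsToNat v.toList := by
  intro v w h
  apply List.Vector.toList_injective
  have hv := natBits_bitsToNat_aux v.toList
  have hw := natBits_bitsToNat_aux w.toList
  rw [List.Vector.toList_length] at hv hw
  simp only at h
  rw [← hv, ← hw, h]

/-- The reduced table oracle answers a well-formed query `v` by the table at the reduced point.
[cite: AaronsonChen2017, §7.2 (p. 29)] -/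
theorem reduceOracle_oracleOfTable_toList (a : ℕ) (h : List.Vector Bool m → List.Vector Bool m)
    (v : List.Vector Bool m) : reduceOracle a (oracleOfTable h) v.toList = (h (redV a v)).toList := by
  rw [reduceOracle_apply, ← oracleOfTable_toList h (redV a v)]
  simp

/-- The reduced table oracle answers a query of length `m` by the table at the reduced point.
[cite: AaronsonChen2017, §7.2 (p. 29)] -/
theorem reduceOracle_oracleOfTable_of_length_eq (a : ℕ) (h : List.Vector Bool m → List.Vector Bool m)
    {q : List Bool} (hq : q.length = m) :
    reduceOracle a (oracleOfTable h) q = (h (redV a ⟨q, hq⟩)).toList :=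
  reduceOracle_oracleOfTable_toList a h ⟨q, hq⟩

/-- The reduced table oracle answers an ill-formed query by `[]`. [cite: AaronsonChen2017, §7.2 (p. 29)] -/
theorem reduceOracle_oracleOfTable_of_length_ne (a : ℕ) (h : List.Vector Bool m → List.Vector Bool m)
    {q : List Bool} (hq : q.length ≠ m) : reduceOracle a (oracleOfTable h) q = [] := by
  rw [reduceOracle_apply, oracleOfTable_apply_of_length_ne]
  rw [length_modReduce]
  exact hq

/-! ### Lazy-sampling states of the two games -/

/-- No two assigned points of the partial table are congruent modulo `a` ("`A` never queries its
oracle on two points `x ≡ x' (mod a)`", so far). [cite: AaronsonChen2017, App. 13 (p. 42)] -/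
def PTable.NonCong (a : ℕ) (τ : PTable m) : Prop :=
  ∀ v w yv yw, τ v = some yv → τ w = some yw →
    bitsToNat v.toList % a = bitsToNat w.toList % a → v = w

/-- The partial table `τ'` of the REDUCED game is the push-forward of the partial table `τ` of the
plain game along `v ↦ v mod a` (same values at reduced points, nothing else assigned).
[cite: AaronsonChen2017, App. 13 (p. 42)] -/
def PTable.RedRel (a : ℕ) (τ τ' : PTable m) : Prop :=
  (∀ v y, τ v = some y → τ' (redV a v) = some y) ∧
    ∀ u y, τ' u = some y → ∃ v, τ v = some y ∧ redV a v = u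

/-- **The collision event**: among the assigned points of `τ` and the well-formed queries of the
list `L` there are two distinct points congruent modulo `a`. [cite: AaronsonChen2017, App. 13 (p. 42)] -/
def CollIn (a : ℕ) (τ : PTable m) (L : List (List Bool)) : Prop :=
  ∃ v w : List.Vector Bool m, v ≠ w ∧ bitsToNat v.toList % a = bitsToNat w.toList % a ∧
    (τ v ≠ none ∨ v.toList ∈ L) ∧ (τ w ≠ none ∨ w.toList ∈ L)

/-- An ill-formed query does not change the collision event. [folklore] -/
theorem collIn_cons_of_length_ne {a : ℕ} {τ : PTable m} {q : List Bool} (hq : q.length ≠ m)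
    (L : List (List Bool)) : CollIn a τ (q :: L) ↔ CollIn a τ L := by
  have key : ∀ v : List.Vector Bool m, v.toList ∈ q :: L ↔ v.toList ∈ L := fun v => by
    rw [List.mem_cons, or_iff_right]
    intro h
    exact hq (h ▸ v.toList_length)
  simp only [CollIn, key]

/-- A query at an already assigned point does not change the collision event. [folklore] -/
theorem collIn_cons_of_ne_none {a : ℕ} {τ : PTable m} {u : List.Vector Bool m} (hu : τ u ≠ none)
    (L : List (List Bool)) : CollIn a τ (u.toList :: L) ↔ CollIn a τ L := by
  have key : ∀ v : List.Vector Bool m, (τ v ≠ none ∨ v.toList ∈ u.toList :: L) ↔ (τ v ≠ none ∨ v.toList ∈ L) := by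
    intro v
    rw [List.mem_cons]
    constructor
    · rintro (h | h | h)
      · exact Or.inl h
      · rw [List.Vector.toList_injective h]; exact Or.inl hu
      · exact Or.inr h
    · rintro (h | h)
      · exact Or.inl h
      · exact Or.inr (Or.inr h)
  simp only [CollIn, key]

/-- A query at a fresh point, recorded in the list or in the table: the same collision event. [folklore] -/
theorem collIn_cons_iff_update {a : ℕ} {τ : PTable m} {u : List.Vector Bool m}
    (y : List.Vector Bool m) (L : List (List Bool)) :
    CollIn a τ (u.toList :: L) ↔ CollIn a (Function.update τ u (some y)) L := by
  have key : ∀ v : List.Vector Bool m, (τ v ≠ none ∨ v.toList ∈ u.toList :: L) ↔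
      (Function.update τ u (some y) v ≠ none ∨ v.toList ∈ L) := by
    intro v
    by_cases hvu : v = u
    · subst hvu
      simp
    · rw [Function.update_of_ne hvu, List.mem_cons]
      have : v.toList ≠ u.toList := fun h => hvu (List.Vector.toList_injective h)
      simp [this]
  simp only [CollIn, key]

/-- Non-congruence survives the assignment of a fresh point not congruent to the assigned ones.
[folklore] -/
theorem PTable.NonCong.update {a : ℕ} {τ : PTable m} (hτ : PTable.NonCong a τ) {u : List.Vector Bool m}
    (hfresh : ∀ w yw, τ w = some yw → bitsToNat w.toList % a ≠ bitsToNat u.toList % a)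
    (y : List.Vector Bool m) : PTable.NonCong a (Function.update τ u (some y)) := by
  intro v w yv yw hv hw hcong
  by_cases hvu : v = u
  · by_cases hwu : w = u
    · rw [hvu, hwu]
    · subst hvu
      rw [Function.update_of_ne hwu] at hw
      exact absurd hcong.symm (hfresh w yw hw)
  · rw [Function.update_of_ne hvu] at hv
    by_cases hwu : w = u
    · subst hwu
      exact absurd hcong (hfresh v yv hv)
    · rw [Function.update_of_ne hwu] at hw
      exact hτ v w yv yw hv hw hcong

/-- The push-forward relation survives the simultaneous assignment of a fresh non-congruent point
and of its reduction. [folklore] -/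
theorem PTable.RedRel.update {a : ℕ} {τ τ' : PTable m} (hR : PTable.RedRel a τ τ') {u : List.Vector Bool m}
    (hu : τ u = none)
    (hfresh : ∀ w yw, τ w = some yw → bitsToNat w.toList % a ≠ bitsToNat u.toList % a)
    (y : List.Vector Bool m) :
    PTable.RedRel a (Function.update τ u (some y)) (Function.update τ' (redV a u) (some y)) := by
  constructor
  · intro w t hw
    by_cases hwu : w = u
    · subst hwu
      rw [Function.update_self] at hw ⊢
      exact hw
    · rw [Function.update_of_ne hwu] at hw
      have hne : redV a w ≠ redV a u := fun h =>
        hfresh w t hw ((redV_eq_redV_iff a w u).1 h)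
      rw [Function.update_of_ne hne]
      exact hR.1 w t hw
  · intro x t hx
    by_cases hxu : x = redV a u
    · subst hxu
      rw [Function.update_self] at hx
      cases hx
      exact ⟨u, Function.update_self _ _ _, rfl⟩
    · rw [Function.update_of_ne hxu] at hx
      obtain ⟨w, hw, rfl⟩ := hR.2 x t hx
      have hwu : w ≠ u := by rintro rfl; rw [hu] at hw; exact absurd hw.symm (Option.some_ne_none t)
      exact ⟨w, by rw [Function.update_of_ne hwu]; exact hw, rfl⟩

/-- One round of the transcript (definitional). [folklore] -/
private theorem queriesAux_succ' (M : OracleAlg β) (O : Oracle) (x : List Bool) (k : ℕ)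
    (answers : List (List Bool)) :
    M.queriesAux O x (k + 1) answers =
      match M.step x answers with
      | Sum.inl q => q :: M.queriesAux O x k (answers ++ [O q])
      | Sum.inr _ => [] :=
  rfl

/-- Two probabilities differ by at most one. [folklore] -/
private theorem abs_sub_le_one_of_mem {p q : ℝ} (hp0 : 0 ≤ p) (hp1 : p ≤ 1) (hq0 : 0 ≤ q) (hq1 : q ≤ 1) :
    |p - q| ≤ 1 := by
  rw [abs_le]; constructor <;> linarith

/-! ### Identical until a collision -/

/-- **Identical until a collision (conditioned on partial tables).** For a deterministic transcript
algorithm `M` on input `z`, continued from the answers `ans` with fuel `k`, a FIXED modulus `a`, a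
partial table `τ` of the plain game without congruent assigned points and its push-forward `τ'`:
the probability of any output event `E` for the run against the REDUCED table oracle of a uniformly
random function extending `τ'`, and for the run against the table oracle of a uniformly random
function extending `τ`, differ by at most the probability (in the latter game) that two distinct
well-formed points among the assigned ones and the queries asked are congruent modulo `a` ("as long
as `A` never queries its oracle on two points `x` and `x'` such that `x ≡ x' (mod a)`, the oracle
will look random"). [cite: AaronsonChen2017, App. 13 (p. 42)] -/
theorem abs_prF_reduce_sub_prF_le (M : OracleAlg β) (z : List Bool) (E : Set (Option β)) (a : ℕ) :
    ∀ (k : ℕ) (ans : List (List Bool)) (τ τ' : PTable m), PTable.NonCong a τ → PTable.RedRel a τ τ' →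
      |prF τ' (fun h => M.runAux (reduceOracle a (oracleOfTable h)) z k ans ∈ E) -
          prF τ (fun h => M.runAux (oracleOfTable h) z k ans ∈ E)| ≤
        prF τ (fun h => CollIn a τ (M.queriesAux (oracleOfTable h) z k ans)) := by
  classical
  intro k
  induction k with
  | zero =>
    intro ans τ τ' _ _
    simp only [OracleAlg.runAux_zero]
    rw [prF_const, prF_const, sub_self, abs_zero]
    exact prF_nonneg _ _
  | succ k ih =>
    intro ans τ τ' hτ hR
    cases hs : M.step z ans with
    | inr b =>
      have hev : ∀ (O : (List.Vector Bool m → List.Vector Bool m) → Oracle)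
          (f : List.Vector Bool m → List.Vector Bool m),
          (M.runAux (O f) z (k + 1) ans ∈ E ↔ some b ∈ E) := fun O f => by
        simp only [OracleAlg.runAux_succ, hs]
      rw [prF_congr (fun f _ => hev (fun f => reduceOracle a (oracleOfTable f)) f),
        prF_congr (fun f _ => hev (fun f => oracleOfTable f) f), prF_const, prF_const, sub_self,
        abs_zero]
      exact prF_nonneg _ _
    | inl q =>
      by_cases hq : q.length = m
      · -- a well-formed query `v`
        set v : List.Vector Bool m := ⟨q, hq⟩ with hvdef
        have hqv : q = v.toList := rfl
        cases hτv : τ v with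
        | some y =>
          -- repeated query: answered by the table in both games
          have hevP : ∀ f : List.Vector Bool m → List.Vector Bool m, τ.Extends f →
              (M.runAux (oracleOfTable f) z (k + 1) ans ∈ E ↔
                M.runAux (oracleOfTable f) z k (ans ++ [y.toList]) ∈ E) := fun f hf => by
            simp only [OracleAlg.runAux_succ, hs, oracleOfTable_apply_of_length_eq f hq]
            rw [← hvdef, hf v y hτv]
          have hevQ : ∀ f : List.Vector Bool m → List.Vector Bool m, τ'.Extends f →
              (M.runAux (reduceOracle a (oracleOfTable f)) z (k + 1) ans ∈ E ↔
                M.runAux (reduceOracle a (oracleOfTable f)) z k (ans ++ [y.toList]) ∈ E) := fun f hf => by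
            simp only [OracleAlg.runAux_succ, hs, reduceOracle_oracleOfTable_of_length_eq a f hq]
            rw [← hvdef, hf (redV a v) y (hR.1 v y hτv)]
          have hevC : ∀ f : List.Vector Bool m → List.Vector Bool m, τ.Extends f →
              (CollIn a τ (M.queriesAux (oracleOfTable f) z (k + 1) ans) ↔
                CollIn a τ (M.queriesAux (oracleOfTable f) z k (ans ++ [y.toList]))) := fun f hf => by
            rw [queriesAux_succ', hs]
            dsimp only
            rw [oracleOfTable_apply_of_length_eq f hq, ← hvdef, hf v y hτv, hqv,
              collIn_cons_of_ne_none (by rw [hτv]; exact Option.some_ne_none y)]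
          rw [prF_congr hevQ, prF_congr hevP, prF_congr hevC]
          exact ih _ τ τ' hτ hR
        | none =>
          by_cases hex : ∃ w yw, τ w = some yw ∧ bitsToNat w.toList % a = bitsToNat v.toList % a
          · -- a fresh query congruent to an assigned point: THE COLLISION
            obtain ⟨w, yw, hw, hcong⟩ := hex
            have hcoll : ∀ f : List.Vector Bool m → List.Vector Bool m, τ.Extends f →
                (CollIn a τ (M.queriesAux (oracleOfTable f) z (k + 1) ans) ↔ True) := fun f _ => by
              rw [queriesAux_succ', hs, iff_true]
              refine ⟨v, w, ?_, hcong.symm, Or.inr (by simp [hqv]), Or.inl (by rw [hw]; simp)⟩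
              rintro rfl
              rw [hτv] at hw
              exact absurd hw.symm (Option.some_ne_none yw)
            rw [prF_congr hcoll, prF_true]
            exact abs_sub_le_one_of_mem (prF_nonneg _ _) (prF_le_one _ _) (prF_nonneg _ _) (prF_le_one _ _)
          · -- a fresh query not congruent to any assigned point: lazy sampling in both games
            push Not at hex
            have hτ'v : τ' (redV a v) = none := by
              by_contra hne
              obtain ⟨t, ht⟩ := Option.ne_none_iff_exists'.1 hne
              obtain ⟨w, hw, hwv⟩ := hR.2 _ t ht
              exact hex w t hw ((redV_eq_redV_iff a w v).1 hwv)
            have hevP : ∀ (y : List.Vector Bool m) (f : List.Vector Bool m → List.Vector Bool m),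
                PTable.Extends (Function.update τ v (some y)) f →
                (M.runAux (oracleOfTable f) z (k + 1) ans ∈ E ↔
                  M.runAux (oracleOfTable f) z k (ans ++ [y.toList]) ∈ E) := fun y f hf => by
              have hfv : f v = y := ((PTable.extends_update_iff hτv y f).1 hf).2
              simp only [OracleAlg.runAux_succ, hs, oracleOfTable_apply_of_length_eq f hq]
              rw [← hvdef, hfv]
            have hevQ : ∀ (y : List.Vector Bool m) (f : List.Vector Bool m → List.Vector Bool m),
                PTable.Extends (Function.update τ' (redV a v) (some y)) f →
                (M.runAux (reduceOracle a (oracleOfTable f)) z (k + 1) ans ∈ E ↔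
                  M.runAux (reduceOracle a (oracleOfTable f)) z k (ans ++ [y.toList]) ∈ E) := fun y f hf => by
              have hfv : f (redV a v) = y := ((PTable.extends_update_iff hτ'v y f).1 hf).2
              simp only [OracleAlg.runAux_succ, hs, reduceOracle_oracleOfTable_of_length_eq a f hq]
              rw [← hvdef, hfv]
            have hevC : ∀ (y : List.Vector Bool m) (f : List.Vector Bool m → List.Vector Bool m),
                PTable.Extends (Function.update τ v (some y)) f →
                (CollIn a τ (M.queriesAux (oracleOfTable f) z (k + 1) ans) ↔
                  CollIn a (Function.update τ v (some y))
                    (M.queriesAux (oracleOfTable f) z k (ans ++ [y.toList]))) := fun y f hf => by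
              have hfv : f v = y := ((PTable.extends_update_iff hτv y f).1 hf).2
              rw [queriesAux_succ', hs]
              dsimp only
              rw [oracleOfTable_apply_of_length_eq f hq, ← hvdef, hfv, hqv, collIn_cons_iff_update]
            rw [prF_fresh hτ'v hevQ, prF_fresh hτv hevP, prF_fresh hτv hevC]
            have hN : (0 : ℝ) < 2 ^ m := by positivity
            have hIH : ∀ y : List.Vector Bool m,
                |prF (Function.update τ' (redV a v) (some y))
                      (fun h => M.runAux (reduceOracle a (oracleOfTable h)) z k (ans ++ [y.toList]) ∈ E) -
                    prF (Function.update τ v (some y))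
                      (fun h => M.runAux (oracleOfTable h) z k (ans ++ [y.toList]) ∈ E)| ≤
                  prF (Function.update τ v (some y)) (fun h =>
                    CollIn a (Function.update τ v (some y))
                      (M.queriesAux (oracleOfTable h) z k (ans ++ [y.toList]))) := fun y =>
              ih _ _ _ (hτ.update hex y) (hR.update hτv hex y)
            rw [← sub_div, ← Finset.sum_sub_distrib, abs_div, abs_of_pos hN]
            refine div_le_div_of_nonneg_right ?_ hN.le
            exact (Finset.abs_sum_le_sum_abs _ _).trans (Finset.sum_le_sum fun y _ => hIH y)
      · -- ill-formed query: answered `[]` in both games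
        have hevP : ∀ f : List.Vector Bool m → List.Vector Bool m,
            (M.runAux (oracleOfTable f) z (k + 1) ans ∈ E ↔
              M.runAux (oracleOfTable f) z k (ans ++ [[]]) ∈ E) := fun f => by
          simp only [OracleAlg.runAux_succ, hs, oracleOfTable_apply_of_length_ne f hq]
        have hevQ : ∀ f : List.Vector Bool m → List.Vector Bool m,
            (M.runAux (reduceOracle a (oracleOfTable f)) z (k + 1) ans ∈ E ↔
              M.runAux (reduceOracle a (oracleOfTable f)) z k (ans ++ [[]]) ∈ E) := fun f => by
          simp only [OracleAlg.runAux_succ, hs, reduceOracle_oracleOfTable_of_length_ne a f hq]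
        have hevC : ∀ f : List.Vector Bool m → List.Vector Bool m,
            (CollIn a τ (M.queriesAux (oracleOfTable f) z (k + 1) ans) ↔
              CollIn a τ (M.queriesAux (oracleOfTable f) z k (ans ++ [[]]))) := fun f => by
          rw [queriesAux_succ', hs]
          dsimp only
          rw [oracleOfTable_apply_of_length_ne f hq, collIn_cons_of_length_ne hq]
        rw [prF_congr (fun f _ => hevQ f), prF_congr (fun f _ => hevP f), prF_congr (fun f _ => hevC f)]
        exact ih _ τ τ' hτ hR

/-- **Identical until a collision, unconditioned**: against the reduced table oracle of a uniformly
random function on `{0,1}^m` versus the table oracle itself, the output distribution of a fuel-`k`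
transcript algorithm changes, on every event, by at most the probability that the plain run asks two
distinct well-formed queries congruent modulo `a`. [cite: AaronsonChen2017, App. 13 (p. 42, eq. (neg-lig))] -/
theorem abs_prF_reduce_sub_prF_le_root (M : OracleAlg β) (z : List Bool) (E : Set (Option β)) (a k : ℕ) :
    |prF (fun _ => none) (fun h : List.Vector Bool m → List.Vector Bool m =>
          M.runAux (reduceOracle a (oracleOfTable h)) z k [] ∈ E) -
        prF (fun _ => none) (fun h : List.Vector Bool m → List.Vector Bool m =>
          M.runAux (oracleOfTable h) z k [] ∈ E)| ≤
      prF (fun _ => none) (fun h : List.Vector Bool m → List.Vector Bool m =>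
        ∃ v w : List.Vector Bool m, v ≠ w ∧ bitsToNat v.toList % a = bitsToNat w.toList % a ∧
          v.toList ∈ M.queriesAux (oracleOfTable h) z k [] ∧ w.toList ∈ M.queriesAux (oracleOfTable h) z k []) := by
  have hτ : PTable.NonCong (m := m) a (fun _ => none) := fun v w yv yw hv _ _ =>
    (Option.some_ne_none _ hv.symm).elim
  have hR : PTable.RedRel (m := m) a (fun _ => none) (fun _ => none) :=
    ⟨fun v y hv => (Option.some_ne_none _ hv.symm).elim, fun u y hu => (Option.some_ne_none _ hu.symm).elim⟩
  have h := abs_prF_reduce_sub_prF_le M z E a k [] (fun _ => none) (fun _ => none) hτ hR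
  refine h.trans (le_of_eq (prF_congr fun f _ => ?_))
  simp [CollIn]

/-! ### The union bound over the moduli -/

/-- **Few moduli see a collision in one transcript**: if every pair of distinct points of `{0,1}^m`
is congruent modulo at most `D` of the moduli of `A` ("each difference can be divisible by at most
two different moduli"), then a list of at most `k` queries has a congruent pair of distinct
well-formed queries modulo at most `k² · D` moduli of `A` ("there are `q choose 2` possible
differences"). [cite: AaronsonChen2017, App. 13 (p. 42)] -/
theorem card_filter_coll_le {L : List (List Bool)} {k : ℕ} (hL : L.length ≤ k) (A : Finset ℕ) {D : ℕ}
    (hD : ∀ v w : List.Vector Bool m, v ≠ w →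
      (A.filter fun a => bitsToNat v.toList % a = bitsToNat w.toList % a).card ≤ D) :
    (A.filter fun a => ∃ v w : List.Vector Bool m, v ≠ w ∧
        bitsToNat v.toList % a = bitsToNat w.toList % a ∧ v.toList ∈ L ∧ w.toList ∈ L).card ≤ k ^ 2 * D := by
  classical
  set V : Finset (List.Vector Bool m) := Finset.univ.filter fun v => v.toList ∈ L with hV
  have hVcard : V.card ≤ k := by
    have h1 : V.card ≤ L.toFinset.card := by
      refine Finset.card_le_card_of_injOn (fun v => v.toList) (fun v hv => ?_) ?_
      · exact List.mem_toFinset.2 (Finset.mem_filter.1 hv).2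
      · intro v _ w _ h
        exact List.Vector.toList_injective h
    exact h1.trans ((List.toFinset_card_le L).trans hL)
  have hsub : (A.filter fun a => ∃ v w : List.Vector Bool m, v ≠ w ∧
      bitsToNat v.toList % a = bitsToNat w.toList % a ∧ v.toList ∈ L ∧ w.toList ∈ L) ⊆
      V.offDiag.biUnion fun p => A.filter fun a => bitsToNat p.1.toList % a = bitsToNat p.2.toList % a := by
    intro a ha
    obtain ⟨haA, v, w, hvw, hcong, hv, hw⟩ := Finset.mem_filter.1 ha
    refine Finset.mem_biUnion.2 ⟨(v, w), Finset.mem_offDiag.2 ⟨?_, ?_, hvw⟩, Finset.mem_filter.2 ⟨haA, hcong⟩⟩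
    · exact Finset.mem_filter.2 ⟨Finset.mem_univ _, hv⟩
    · exact Finset.mem_filter.2 ⟨Finset.mem_univ _, hw⟩
  calc (A.filter fun a => ∃ v w : List.Vector Bool m, v ≠ w ∧
          bitsToNat v.toList % a = bitsToNat w.toList % a ∧ v.toList ∈ L ∧ w.toList ∈ L).card
      ≤ (V.offDiag.biUnion fun p => A.filter fun a =>
          bitsToNat p.1.toList % a = bitsToNat p.2.toList % a).card := Finset.card_le_card hsub
    _ ≤ ∑ p ∈ V.offDiag, (A.filter fun a => bitsToNat p.1.toList % a = bitsToNat p.2.toList % a).card :=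
        Finset.card_biUnion_le
    _ ≤ ∑ _p ∈ V.offDiag, D := Finset.sum_le_sum fun p hp => hD p.1 p.2 (Finset.mem_offDiag.1 hp).2.2
    _ = V.offDiag.card * D := by rw [Finset.sum_const, smul_eq_mul]
    _ ≤ k ^ 2 * D := by
        apply Nat.mul_le_mul_right
        rw [Finset.offDiag_card]
        calc V.card * V.card - V.card ≤ V.card * V.card := Nat.sub_le _ _
          _ ≤ k * k := Nat.mul_le_mul hVcard hVcard
          _ = k ^ 2 := (sq k).symm

/-- **The union bound over the moduli**: summed over `a ∈ A`, the collision probabilities of a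
fuel-`k` run against a uniformly random function table are at most `k² · D`.
[cite: AaronsonChen2017, App. 13 (p. 42)] -/
theorem sum_prF_coll_le (M : OracleAlg β) (z : List Bool) (k : ℕ) (A : Finset ℕ) {D : ℕ}
    (hD : ∀ v w : List.Vector Bool m, v ≠ w →
      (A.filter fun a => bitsToNat v.toList % a = bitsToNat w.toList % a).card ≤ D) :
    ∑ a ∈ A, prF (fun _ => none) (fun h : List.Vector Bool m → List.Vector Bool m =>
        ∃ v w : List.Vector Bool m, v ≠ w ∧ bitsToNat v.toList % a = bitsToNat w.toList % a ∧
          v.toList ∈ M.queriesAux (oracleOfTable h) z k [] ∧ w.toList ∈ M.queriesAux (oracleOfTable h) z k []) ≤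
      (k : ℝ) ^ 2 * D := by
  classical
  simp only [prF_bot_eq]
  rw [← Finset.sum_div, div_le_iff₀ (by positivity)]
  have hN : (0 : ℝ) < Fintype.card (List.Vector Bool m → List.Vector Bool m) := by positivity
  -- swap the two counts
  have hswap : (∑ a ∈ A, ((Finset.univ.filter fun h : List.Vector Bool m → List.Vector Bool m =>
      ∃ v w : List.Vector Bool m, v ≠ w ∧ bitsToNat v.toList % a = bitsToNat w.toList % a ∧
        v.toList ∈ M.queriesAux (oracleOfTable h) z k [] ∧
        w.toList ∈ M.queriesAux (oracleOfTable h) z k []).card : ℝ)) =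
      ∑ h : List.Vector Bool m → List.Vector Bool m, ((A.filter fun a =>
        ∃ v w : List.Vector Bool m, v ≠ w ∧ bitsToNat v.toList % a = bitsToNat w.toList % a ∧
          v.toList ∈ M.queriesAux (oracleOfTable h) z k [] ∧
          w.toList ∈ M.queriesAux (oracleOfTable h) z k []).card : ℝ) := by
    simp only [Finset.card_filter]
    push_cast
    exact Finset.sum_comm
  rw [hswap]
  calc ∑ h : List.Vector Bool m → List.Vector Bool m, ((A.filter fun a =>
        ∃ v w : List.Vector Bool m, v ≠ w ∧ bitsToNat v.toList % a = bitsToNat w.toList % a ∧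
          v.toList ∈ M.queriesAux (oracleOfTable h) z k [] ∧
          w.toList ∈ M.queriesAux (oracleOfTable h) z k []).card : ℝ)
      ≤ ∑ _h : List.Vector Bool m → List.Vector Bool m, ((k : ℝ) ^ 2 * D) :=
        Finset.sum_le_sum fun h _ => by
          exact_mod_cast card_filter_coll_le (OracleAlg.length_queriesAux_le M _ z k []) A hD
    _ = (k : ℝ) ^ 2 * D * Fintype.card (List.Vector Bool m → List.Vector Bool m) := by
        rw [Finset.sum_const, Finset.card_univ, nsmul_eq_mul]
        ring

end Collision

/-! ### The ideal game of the reduced oracle and the adversary form -/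

section Games

/-- `prfIdealModProb ℓ a 𝒜 n = Pr_H[𝒜^{H ∘ (mod a)}(1ⁿ) = 1]`: the acceptance probability of the
oracle adversary `𝒜` given the REDUCED oracle of a uniformly random function table
`H : {0,1}^{ℓ n} → {0,1}^{ℓ n}` ("`Pr_{f ← X^X, a}[A^{f_{mod a}}() = 1]`" for one `a`).
[cite: AaronsonChen2017, App. 13 (p. 42)] -/
noncomputable def prfIdealModProb (ℓ : ℕ → ℕ) (a : ℕ) (𝒜 : OracleAdversary Bool) (n : ℕ) : ℝ :=
  (((randomFunctionPMF (ℓ n) (ℓ n)).bind fun H =>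
      𝒜.outputPMF (reduceOracle a (oracleOfTable H)) (unaryEncodeNat n)) (some true)).toReal

/-- `prfIdealModProb` as the expectation over the table of the acceptance probability.
[cite: AaronsonChen2017, App. 13 (p. 42)] -/
theorem prfIdealModProb_eq_tsum (ℓ : ℕ → ℕ) (a : ℕ) (𝒜 : OracleAdversary Bool) (n : ℕ) :
    prfIdealModProb ℓ a 𝒜 n =
      ∑' H : (List.Vector Bool (ℓ n) → List.Vector Bool (ℓ n)),
        (randomFunctionPMF (ℓ n) (ℓ n) H).toReal *
          𝒜.acceptProb (reduceOracle a (oracleOfTable H)) n := by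
  rw [prfIdealModProb, PMF.bind_apply, ENNReal.tsum_toReal_eq]
  · simp_rw [ENNReal.toReal_mul]
    rfl
  · exact fun H => ENNReal.mul_ne_top (PMF.apply_ne_top _ _) (PMF.apply_ne_top _ _)

/-- `prfIdealModProb` is nonnegative. [cite: AaronsonChen2017, App. 13 (p. 42)] -/
theorem prfIdealModProb_nonneg (ℓ : ℕ → ℕ) (a : ℕ) (𝒜 : OracleAdversary Bool) (n : ℕ) :
    0 ≤ prfIdealModProb ℓ a 𝒜 n :=
  ENNReal.toReal_nonneg

/-- `prfIdealModProb` is at most `1`. [cite: AaronsonChen2017, App. 13 (p. 42)] -/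
theorem prfIdealModProb_le_one (ℓ : ℕ → ℕ) (a : ℕ) (𝒜 : OracleAdversary Bool) (n : ℕ) :
    prfIdealModProb ℓ a 𝒜 n ≤ 1 :=
  ENNReal.toReal_le_of_le_ofReal zero_le_one (by rw [ENNReal.ofReal_one]; exact PMF.coe_le_one _ _)

/-- **The reduced ideal game as an average over the coins** of the probability, over a uniformly
random function table, that the deterministic run against the reduced table oracle accepts.
[cite: AaronsonChen2017, App. 13 (p. 42)] -/
theorem prfIdealModProb_eq_avg (ℓ : ℕ → ℕ) (a : ℕ) (𝒜 : OracleAdversary Bool) (n : ℕ) :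
    prfIdealModProb ℓ a 𝒜 n =
      (∑ r : List.Vector Bool (𝒜.coins.eval (unaryEncodeNat n).length),
          prF (fun _ => none) fun h : List.Vector Bool (ℓ n) → List.Vector Bool (ℓ n) =>
            𝒜.alg.runAux (reduceOracle a (oracleOfTable h)) (boolPair (unaryEncodeNat n) r.toList)
              (𝒜.fuel.eval (unaryEncodeNat n).length) [] = some true) /
        2 ^ 𝒜.coins.eval (unaryEncodeNat n).length := by
  classical
  rw [prfIdealModProb_eq_tsum, tsum_fintype]
  simp only [randomFunctionPMF_apply, OracleAdversary.acceptProb, outputPMF_toReal_eq_card,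
    ENNReal.toReal_inv, ENNReal.toReal_natCast, prF_bot_eq, Finset.card_filter, OracleAlg.run]
  push_cast
  simp only [Finset.sum_div, Finset.mul_sum]
  rw [Finset.sum_comm]
  refine Finset.sum_congr rfl fun r _ => Finset.sum_congr rfl fun h _ => ?_
  ring

/-- The security parameter in unary has length `n`. [folklore] -/
private theorem length_unaryEncodeNat_aux' (n : ℕ) : (unaryEncodeNat n).length = n := by
  induction n with
  | zero => rfl
  | succ n ih => simp [unaryEncodeNat, ih]

/-- **Aaronson–Chen, App. 13, eq. (neg-lig), for oracle adversaries and any family of moduli**: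
for a finite nonempty set `A` of moduli such that two distinct points of `{0,1}^{ℓ n}` are
congruent modulo at most `D` members of `A`, the average over `a ∈ A` of the reduced ideal game
and the ideal PRF game of an oracle adversary with round budget `fuel` differ by at most
`fuel(n)² · D / |A|` ("the total probability of querying two `x` and `x'` such that
`x ≡ x' (mod a)` is at most `O(q² log N/√N)`" once `|A| ≥ Ω(√N / log N)` and `D = 2`).
[cite: AaronsonChen2017, App. 13 (p. 42, eq. (neg-lig))] -/
theorem abs_avg_prfIdealModProb_sub_prfIdealProb_le (ℓ : ℕ → ℕ) (𝒜 : OracleAdversary Bool) (n : ℕ)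
    {A : Finset ℕ} (hA : A.Nonempty) {D : ℕ}
    (hD : ∀ v w : List.Vector Bool (ℓ n), v ≠ w →
      (A.filter fun a => bitsToNat v.toList % a = bitsToNat w.toList % a).card ≤ D) :
    |(∑ a ∈ A, prfIdealModProb ℓ a 𝒜 n) / A.card - prfIdealProb ℓ ℓ 𝒜 n| ≤
      ((𝒜.fuel.eval n : ℕ) : ℝ) ^ 2 * D / A.card := by
  classical
  have hAc : (0 : ℝ) < A.card := by exact_mod_cast hA.card_pos
  set c := 𝒜.coins.eval (unaryEncodeNat n).length with hc
  set K := 𝒜.fuel.eval (unaryEncodeNat n).length with hK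
  have hKn : K = 𝒜.fuel.eval n := by rw [hK, length_unaryEncodeNat_aux']
  have hC : (0 : ℝ) < 2 ^ c := by positivity
  -- the three families of probabilities, per coin string
  set Q : ℕ → List.Vector Bool c → ℝ := fun a r =>
    prF (fun _ => none) fun h : List.Vector Bool (ℓ n) → List.Vector Bool (ℓ n) =>
      𝒜.alg.runAux (reduceOracle a (oracleOfTable h)) (boolPair (unaryEncodeNat n) r.toList) K [] =
        some true with hQ
  set P : List.Vector Bool c → ℝ := fun r =>
    prF (fun _ => none) fun h : List.Vector Bool (ℓ n) → List.Vector Bool (ℓ n) =>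
      𝒜.alg.runAux (oracleOfTable h) (boolPair (unaryEncodeNat n) r.toList) K [] = some true with hP
  set C : ℕ → List.Vector Bool c → ℝ := fun a r =>
    prF (fun _ => none) fun h : List.Vector Bool (ℓ n) → List.Vector Bool (ℓ n) =>
      ∃ v w : List.Vector Bool (ℓ n), v ≠ w ∧ bitsToNat v.toList % a = bitsToNat w.toList % a ∧
        v.toList ∈ 𝒜.alg.queriesAux (oracleOfTable h) (boolPair (unaryEncodeNat n) r.toList) K [] ∧
        w.toList ∈ 𝒜.alg.queriesAux (oracleOfTable h) (boolPair (unaryEncodeNat n) r.toList) K []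
    with hCdef
  have hmod : ∀ a, prfIdealModProb ℓ a 𝒜 n = (∑ r, Q a r) / 2 ^ c := fun a =>
    prfIdealModProb_eq_avg ℓ a 𝒜 n
  have hideal : prfIdealProb ℓ ℓ 𝒜 n = (∑ r, P r) / 2 ^ c := prfIdealProb_eq_avg ℓ 𝒜 n
  -- pointwise: identical until a collision
  have hpt : ∀ a r, |Q a r - P r| ≤ C a r := fun a r => by
    have h := abs_prF_reduce_sub_prF_le_root 𝒜.alg (boolPair (unaryEncodeNat n) r.toList)
      {o | o = some true} a K (m := ℓ n)
    simpa only [Set.mem_setOf_eq] using h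
  -- the union bound, per coin string
  have hsumC : ∀ r, ∑ a ∈ A, C a r ≤ (K : ℝ) ^ 2 * D := fun r =>
    sum_prF_coll_le 𝒜.alg (boolPair (unaryEncodeNat n) r.toList) K A hD
  -- rewrite the difference as a double average
  have hdiff : (∑ a ∈ A, prfIdealModProb ℓ a 𝒜 n) / A.card - prfIdealProb ℓ ℓ 𝒜 n =
      (∑ r, ∑ a ∈ A, (Q a r - P r)) / (2 ^ c * A.card) := by
    simp only [hmod, hideal]
    rw [Finset.sum_comm]
    simp only [Finset.sum_sub_distrib, Finset.sum_const, nsmul_eq_mul, ← Finset.sum_div]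
    field_simp
  rw [hdiff, abs_div, abs_of_pos (by positivity : (0 : ℝ) < 2 ^ c * A.card),
    div_le_div_iff₀ (by positivity) hAc]
  calc |∑ r, ∑ a ∈ A, (Q a r - P r)| * A.card
      ≤ (∑ r, ∑ a ∈ A, |Q a r - P r|) * A.card := by
        refine mul_le_mul_of_nonneg_right ?_ hAc.le
        refine (Finset.abs_sum_le_sum_abs _ _).trans (Finset.sum_le_sum fun r _ => ?_)
        exact Finset.abs_sum_le_sum_abs _ _
    _ ≤ (∑ r, ∑ a ∈ A, C a r) * A.card := by
        refine mul_le_mul_of_nonneg_right ?_ hAc.le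
        exact Finset.sum_le_sum fun r _ => Finset.sum_le_sum fun a _ => hpt a r
    _ ≤ (∑ _r : List.Vector Bool c, (K : ℝ) ^ 2 * D) * A.card :=
        mul_le_mul_of_nonneg_right (Finset.sum_le_sum fun r _ => hsumC r) hAc.le
    _ = ((𝒜.fuel.eval n : ℕ) : ℝ) ^ 2 * D * (2 ^ c * A.card) := by
        rw [Finset.sum_const, Finset.card_univ, card_vector, Fintype.card_bool, nsmul_eq_mul, hKn]
        push_cast
        ring

end Games

end Literature.Computability.Cryptography
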